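import Summits.QuantumAdvantage.AdviceFreeQNC0.WalkGapShots
import Summits.QuantumAdvantage.AdviceFreeQNC0.EliminationHardnessF
import HarnessLib

/-!
# Cell qa-qnc0 (odd primes `p ≥ 5`, route `OddPrimeWalk` crux `ShotsOdd`): the PER-INPUT-SPARSE rung `WalkHardFShots p`

Planner qa-qnc0-p2 g14, route pack `OddPrimeWalk` (D-0145 registration 2026-08-27): item `ShotsOdd` =
`∀ p ≥ 5 prime, WalkHardFShots p` where **`WalkHardFShots p`** (typed here, body VERBATIM from the route pack with `p`
fixed) says: strategies of `𝔽_p`-degree `(log₂ n)^C` that fire AT MOST `B` cuts on every input — positions arbitrary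
and adaptive, potential support dense — with `B³·(log₂ n)^{2C+2} ≤ n` win α's u-walk game `ringWinU` on at most
`θ·2ⁿ` inputs, ONE `θ < 1` for all `C`.  It subsumes qn-prover g10's `TwoShotHardF` (`B = 2`, up to constants) and R4
`WalkHardFSparse` (`s` potentially-active cuts ⇒ `≤ s` shots).  PROVED here:

* **`walkHardFShots_of_elimLevel p`** — from the `elimLevelSqrtF`-shape hypothesis, with `θ = max(1 − η₀/2, 1/2)`:
  take `L = B²(log₂ n)^{2C+1}`, `m = n / L ≥ B·log₂ n` disjoint intervals; one of them is entered by the shots of at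
  most `B·2ⁿ/m ≤ (η₀/2)·2ⁿ` inputs (`exists_quiet_interval`, `log₂ n ≥ 2/η₀`); SURGERY there gives a cut-free strategy
  `y'` agreeing with `y` elsewhere; in each fibre of `y'` the named residue's level sets have degree
  `≤ B·(log₂ n)^C ≤ c₀√L` (`namedRes_levelSet_mem_lowDeg_shots`, `c₀²·log₂ n ≥ 1`), so level-set elimination on the
  `L`-cube yields `≥ η₀·2^L` losses per fibre, `≥ η₀·2ⁿ` in total (`sum_fibre`), hence `≥ (η₀/2)·2ⁿ` losses of `y`.
* **`walkHardFShots (p) (hp3 : p ≠ 3) : WalkHardFShots p`** — UNCONDITIONAL for every prime `p ≠ 3`, over g10's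
  `elimLevelSqrtF` (`EliminationHardnessF.lean`).  The route item then closes by
  `fun p _ hp => walkHardFShots p (by omega)`.

WHAT THIS IS NOT: the DENSE residual (`DenseResidualOdd`: maximal shot count `b` with `b³(log₂ n)^{2C+2} > n`) is the
open crux of the route and is untouched; `p = 3` is excluded in substance (`walkEasyThree` is a 1-shot winning strategy);
separation NOT moved.
-/

noncomputable section

namespace Summit.QuantumAdvantage.AdviceFreeQNC0

open Classical
open Finset
open Literature.Computability.MetaComplexity Literature.Computability.MetaComplexity.Smolensky

variable {n : ℕ}

/-! ### The per-input-sparse rung -/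

/-- **`WalkHardFShots p`** (planner qa-qnc0-p2 g14, route `OddPrimeWalk` item `ShotsOdd` with `p` fixed, body
VERBATIM): strategies of `𝔽_p`-degree `(log₂ n)^C` firing AT MOST `B` cuts on every input (positions arbitrary and
adaptive, potential support dense), with `B³·(log₂ n)^{2C+2} ≤ n`, win α's u-walk game on at most `θ·2ⁿ` inputs, one
`θ < 1` for all `C`. -/
def WalkHardFShots (p : ℕ) [Fact p.Prime] : Prop :=
  ∃ θ : ℝ, θ < 1 ∧ ∀ C : ℕ, ∃ n₀ : ℕ, ∀ n ≥ n₀, ∀ c B : ℕ,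
    ∀ y : Fin (n + 1) → (Fin n → Bool) → Bool,
      (∀ g, HasDegF p (y g) ((Nat.log 2 n) ^ C)) →
      (∀ u, (Finset.univ.filter fun g : Fin (n + 1) => y g u = true).card ≤ B) →
      B ^ 3 * (Nat.log 2 n) ^ (2 * C + 2) ≤ n →
        ((Finset.univ.filter fun u : Fin n → Bool => ringWinU c y u = true).card : ℝ) ≤ θ * (2 : ℝ) ^ n

open GapFibre in
/-- **The shots rung from level-set elimination**: the `elimLevelSqrtF`-shape hypothesis `hE` gives `WalkHardFShots p`
with `θ = max (1 − η₀/2) (1/2)` (random cut-free surgery + the fibre argument with the truncated pattern expansion). -/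
theorem walkHardFShots_of_elimLevel (p : ℕ) [Fact p.Prime]
    (hE : ∃ η₀ : ℝ, 0 < η₀ ∧ ∃ c₀ : ℝ, 0 < c₀ ∧ ∃ n₀ : ℕ, ∀ n ≥ n₀, ∀ d : ℕ, (d : ℝ) ≤ c₀ * Real.sqrt n →
      ∀ e : (Fin n → Bool) → ℕ,
        (∀ r : ℕ, (fun u => if e u % 3 = r % 3 then (1 : ZMod p) else 0) ∈
          Smolensky.lowDeg (ZMod p) n d) →
        η₀ * (2 : ℝ) ^ n ≤ ((Finset.univ.filter fun u : Fin n → Bool =>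
          e u % 3 = Hegedus.wt u % 3).card : ℝ)) :
    WalkHardFShots p := by
  obtain ⟨η₀, hη₀, c₀, hc₀, n₁, H⟩ := hE
  refine ⟨max (1 - η₀ / 2) (1 / 2), max_lt (by linarith) (by norm_num), fun C => ?_⟩
  obtain ⟨K, hK⟩ : ∃ K : ℕ, K = max 2 (max (max (⌈1 / c₀ ^ 2⌉₊) n₁) (⌈2 / η₀⌉₊)) := ⟨_, rfl⟩
  refine ⟨2 ^ K, fun n hn c B y hdeg hshots hbud => ?_⟩
  have hθ : 1 - η₀ / 2 ≤ max (1 - η₀ / 2) (1 / 2) := le_max_left _ _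
  have hθ' : (1 : ℝ) / 2 ≤ max (1 - η₀ / 2) (1 / 2) := le_max_right _ _
  have h2n : (0 : ℝ) < (2 : ℝ) ^ n := by positivity
  have hlogK : K ≤ Nat.log 2 n := Nat.le_log_of_pow_le (by norm_num) hn
  have hlog2 : 2 ≤ Nat.log 2 n := le_trans (by rw [hK]; exact le_max_left _ _) hlogK
  have hlogn₁ : n₁ ≤ Nat.log 2 n := le_trans (by
    rw [hK]; exact le_trans (le_trans (le_max_right _ _) (le_max_left _ _)) (le_max_right _ _)) hlogK
  have hlogc : 1 / c₀ ^ 2 ≤ (Nat.log 2 n : ℝ) := by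
    have h1 : (⌈1 / c₀ ^ 2⌉₊ : ℕ) ≤ Nat.log 2 n := le_trans (by
      rw [hK]; exact le_trans (le_trans (le_max_left _ _) (le_max_left _ _)) (le_max_right _ _)) hlogK
    exact le_trans (Nat.le_ceil _) (by exact_mod_cast h1)
  have hlogη : 2 / η₀ ≤ (Nat.log 2 n : ℝ) := by
    have h1 : (⌈2 / η₀⌉₊ : ℕ) ≤ Nat.log 2 n := le_trans (by
      rw [hK]; exact le_trans (le_max_right _ _) (le_max_right _ _)) hlogK
    exact le_trans (Nat.le_ceil _) (by exact_mod_cast h1)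
  -- the win/loss bookkeeping for `y`
  have htot : ∀ y' : Fin (n + 1) → (Fin n → Bool) → Bool,
      ((univ.filter fun u : Fin n → Bool => ringWinU c y' u = true).card : ℝ) +
      ((univ.filter fun u : Fin n → Bool => ringWinU c y' u = false).card : ℝ) = (2 : ℝ) ^ n := by
    intro y'
    have h := Finset.card_filter_add_card_filter_not (s := (univ : Finset (Fin n → Bool)))
      (fun u : Fin n → Bool => ringWinU c y' u = true)
    have hneg : (univ.filter fun u : Fin n → Bool => ¬ ringWinU c y' u = true) =
        univ.filter fun u : Fin n → Bool => ringWinU c y' u = false :=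
      Finset.filter_congr fun u _ => by simp
    rw [hneg, card_univ, Fintype.card_fun, Fintype.card_bool, Fintype.card_fin] at h
    exact_mod_cast h
  by_cases hB : B = 0
  · -- no shots at all: nobody ever wins
    have hnone : ∀ u : Fin n → Bool, ringWinU c y u = false := by
      intro u
      unfold ringWinU
      rw [decide_eq_false_iff_not]
      have h0 : (univ.filter fun g : Fin (n + 1) =>
          y g u = true ∧ (c + g.val + walkExp u g.val) % 3 ≠ 0) = ∅ := by
        rw [← Finset.card_eq_zero]
        have h1 := hshots u
        rw [hB, Nat.le_zero, Finset.card_eq_zero] at h1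
        rw [Finset.card_eq_zero, Finset.eq_empty_iff_forall_notMem]
        intro g hg
        rw [mem_filter] at hg
        have : g ∈ (univ.filter fun g : Fin (n + 1) => y g u = true) := by
          rw [mem_filter]; exact ⟨mem_univ _, hg.2.1⟩
        rw [h1] at this
        exact Finset.notMem_empty g this
      rw [h0, card_empty]
      omega
    have hwin0 : (univ.filter fun u : Fin n → Bool => ringWinU c y u = true).card = 0 := by
      rw [Finset.card_eq_zero, Finset.eq_empty_iff_forall_notMem]
      intro u hu
      rw [mem_filter, hnone u] at hu
      exact Bool.false_ne_true hu.2
    rw [hwin0]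
    push_cast
    nlinarith
  · -- `B ≥ 1`: surgery on a quiet interval of length `L = B²·(log₂ n)^{2C+1}`
    have hB1 : 1 ≤ B := Nat.one_le_iff_ne_zero.2 hB
    obtain ⟨L, hL⟩ : ∃ L : ℕ, L = B ^ 2 * (Nat.log 2 n) ^ (2 * C + 1) := ⟨_, rfl⟩
    have hLpos : 0 < L := by rw [hL]; positivity
    -- `B·L·log₂ n ≤ n`
    have hBLn : B * L * Nat.log 2 n ≤ n := by
      calc B * L * Nat.log 2 n = B ^ 3 * (Nat.log 2 n) ^ (2 * C + 2) := by rw [hL]; ring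
        _ ≤ n := hbud
    have hLn : L ≤ n := le_trans (by
      calc L = 1 * L * 1 := by ring
        _ ≤ B * L * Nat.log 2 n := Nat.mul_le_mul (Nat.mul_le_mul_right _ hB1) (by omega)) hBLn
    obtain ⟨m, hm⟩ : ∃ m : ℕ, m = n / L := ⟨_, rfl⟩
    have hmB : B * Nat.log 2 n ≤ m := by
      rw [hm, Nat.le_div_iff_mul_le hLpos]
      calc B * Nat.log 2 n * L = B * L * Nat.log 2 n := by ring
        _ ≤ n := hBLn
    have hmpos : 0 < m := lt_of_lt_of_le (by positivity) hmB
    have hmL : m * L ≤ n := by rw [hm]; exact Nat.div_mul_le_self n L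
    -- the quiet interval
    obtain ⟨k, hk, hquiet⟩ := exists_quiet_interval L m hmpos y hshots
    have hiL : k * L + L ≤ n := by
      calc k * L + L = (k + 1) * L := by ring
        _ ≤ m * L := Nat.mul_le_mul_right _ hk
        _ ≤ n := hmL
    -- the operated strategy
    set y' := surgery (k * L) L y with hy'
    have hdeg' : ∀ g, HasDegF p (y' g) ((Nat.log 2 n) ^ C) := fun g => hasDegF_surgery _ _ hdeg g
    have hshots' : ∀ u : Fin n → Bool, (univ.filter fun g : Fin (n + 1) => y' g u = true).card ≤ B :=
      fun u => le_trans (shots_surgery_le _ _ y u) (hshots u)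
    have hcf : CutFree (k * L) L y' := cutFree_surgery _ _ y
    -- thresholds for the fibre argument
    have hLn₁ : n₁ ≤ L := by
      refine le_trans hlogn₁ ?_
      calc Nat.log 2 n = 1 * (Nat.log 2 n) ^ 1 := by ring
        _ ≤ B ^ 2 * (Nat.log 2 n) ^ (2 * C + 1) :=
            Nat.mul_le_mul (Nat.one_le_pow _ _ hB1) (Nat.pow_le_pow_right (by omega) (by omega))
        _ = L := hL.symm
    have hd : ((B * (Nat.log 2 n) ^ C : ℕ) : ℝ) ≤ c₀ * Real.sqrt L := by
      -- `(B·D)² ≤ c₀²·L` since `c₀²·log₂ n ≥ 1`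
      have hc1 : (1 : ℝ) ≤ c₀ ^ 2 * (Nat.log 2 n : ℝ) := by
        rw [div_le_iff₀ (by positivity)] at hlogc
        linarith
      have hx0 : (0 : ℝ) ≤ ((B * (Nat.log 2 n) ^ C : ℕ) : ℝ) := by positivity
      have key : (((B * (Nat.log 2 n) ^ C : ℕ) : ℝ)) ^ 2 ≤ c₀ ^ 2 * (L : ℝ) := by
        have hLr : (L : ℝ) = (B : ℝ) ^ 2 * (Nat.log 2 n : ℝ) ^ (2 * C + 1) := by
          rw [hL]; push_cast; ring
        rw [hLr]
        have hx : (0 : ℝ) ≤ ((B : ℝ) * (Nat.log 2 n : ℝ) ^ C) ^ 2 := by positivity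
        calc (((B * (Nat.log 2 n) ^ C : ℕ) : ℝ)) ^ 2 = ((B : ℝ) * (Nat.log 2 n : ℝ) ^ C) ^ 2 * 1 := by
              push_cast; ring
          _ ≤ ((B : ℝ) * (Nat.log 2 n : ℝ) ^ C) ^ 2 * (c₀ ^ 2 * (Nat.log 2 n : ℝ)) :=
              mul_le_mul_of_nonneg_left hc1 hx
          _ = c₀ ^ 2 * ((B : ℝ) ^ 2 * (Nat.log 2 n : ℝ) ^ (2 * C + 1)) := by ring
      calc ((B * (Nat.log 2 n) ^ C : ℕ) : ℝ) = Real.sqrt ((((B * (Nat.log 2 n) ^ C : ℕ) : ℝ)) ^ 2) :=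
            (Real.sqrt_sq hx0).symm
        _ ≤ Real.sqrt (c₀ ^ 2 * (L : ℝ)) := Real.sqrt_le_sqrt key
        _ = c₀ * Real.sqrt L := by rw [Real.sqrt_mul (by positivity), Real.sqrt_sq hc₀.le]
    -- every fibre of `y'` has `≥ η₀·2^L` losses
    have hfibre : ∀ u : Fin n → Bool, η₀ * (2 : ℝ) ^ L ≤
        ((univ.filter fun z : Fin L → Bool => ringWinU c y' (ow (k * L) L u z) = false).card : ℝ) := by
      intro u
      have hH := H L hLn₁ (B * (Nat.log 2 n) ^ C) hd (namedRes (k * L) L c y' u)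
        (fun r => namedRes_levelSet_mem_lowDeg_shots y' hdeg' hshots' u r)
      refine le_trans hH ?_
      exact_mod_cast Finset.card_le_card (fun z hz => by
        rw [mem_filter] at hz ⊢
        exact ⟨mem_univ _, ringWinU_ow_eq_false_of_hit hiL c y' hcf u z hz.2⟩)
    have hcount : (2 : ℝ) ^ L * ((univ.filter fun u : Fin n → Bool => ringWinU c y' u = false).card : ℝ) =
        ∑ u : Fin n → Bool,
          ((univ.filter fun z : Fin L → Bool => ringWinU c y' (ow (k * L) L u z) = false).card : ℝ) := by
      have h := sum_fibre hiL (fun u => if ringWinU c y' u = false then (1 : ℝ) else 0)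
      simp only [Finset.sum_boole] at h
      exact h
    have hloss' : η₀ * (2 : ℝ) ^ n ≤
        ((univ.filter fun u : Fin n → Bool => ringWinU c y' u = false).card : ℝ) := by
      have h2L : (0 : ℝ) < (2 : ℝ) ^ L := by positivity
      refine le_of_mul_le_mul_left ?_ h2L
      rw [hcount]
      calc (2 : ℝ) ^ L * (η₀ * (2 : ℝ) ^ n) = ∑ _u : Fin n → Bool, η₀ * (2 : ℝ) ^ L := by
            rw [Finset.sum_const, Finset.card_univ, Fintype.card_fun, Fintype.card_bool, Fintype.card_fin,
              nsmul_eq_mul]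
            push_cast
            ring
        _ ≤ _ := Finset.sum_le_sum fun u _ => hfibre u
    -- losses of `y` ≥ losses of `y'` − (inputs entering the quiet interval)
    have hcompare : (univ.filter fun u : Fin n → Bool => ringWinU c y' u = false).card ≤
        (univ.filter fun u : Fin n → Bool => ringWinU c y u = false).card +
        (univ.filter fun u : Fin n → Bool =>
          ∃ g : Fin (n + 1), (k * L < g.val ∧ g.val < k * L + L) ∧ y g u = true).card := by
      refine le_trans (Finset.card_le_card fun u hu => ?_) (Finset.card_union_le _ _)
      rw [mem_filter] at hu
      rw [Finset.mem_union, mem_filter, mem_filter]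
      by_cases hent : ∃ g : Fin (n + 1), (k * L < g.val ∧ g.val < k * L + L) ∧ y g u = true
      · exact Or.inr ⟨mem_univ _, hent⟩
      · left
        refine ⟨mem_univ _, ?_⟩
        push Not at hent
        rw [← ringWinU_surgery_eq (k * L) L c y u (fun g hg => ?_)]
        · exact hu.2
        · have := hent g hg
          simpa using this
    -- the entering set is small: `m·#enter ≤ B·2ⁿ`, `m ≥ B·log₂ n ≥ 2B/η₀`
    have henter : (((univ.filter fun u : Fin n → Bool =>
        ∃ g : Fin (n + 1), (k * L < g.val ∧ g.val < k * L + L) ∧ y g u = true).card : ℕ) : ℝ) ≤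
        η₀ / 2 * (2 : ℝ) ^ n := by
      have hq : ((m : ℕ) : ℝ) * ((univ.filter fun u : Fin n → Bool =>
          ∃ g : Fin (n + 1), (k * L < g.val ∧ g.val < k * L + L) ∧ y g u = true).card : ℝ) ≤
          (B : ℝ) * (2 : ℝ) ^ n := by exact_mod_cast hquiet
      have hmr : (B : ℝ) * (Nat.log 2 n : ℝ) ≤ (m : ℝ) := by exact_mod_cast hmB
      have hBpos : (0 : ℝ) < B := by exact_mod_cast hB1
      have h2B : 2 * (B : ℝ) ≤ η₀ * (m : ℝ) := by
        have h1 : (2 : ℝ) ≤ η₀ * (Nat.log 2 n : ℝ) := by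
          rw [div_le_iff₀ hη₀] at hlogη; linarith
        nlinarith
      -- `2B · #enter ≤ η₀ · m · #enter ≤ η₀ · B · 2ⁿ`
      have hE0 : (0 : ℝ) ≤ ((univ.filter fun u : Fin n → Bool =>
          ∃ g : Fin (n + 1), (k * L < g.val ∧ g.val < k * L + L) ∧ y g u = true).card : ℝ) := by positivity
      nlinarith
    have hlossR : ((univ.filter fun u : Fin n → Bool => ringWinU c y' u = false).card : ℝ) ≤
        ((univ.filter fun u : Fin n → Bool => ringWinU c y u = false).card : ℝ) +
        ((univ.filter fun u : Fin n → Bool =>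
          ∃ g : Fin (n + 1), (k * L < g.val ∧ g.val < k * L + L) ∧ y g u = true).card : ℝ) := by
      exact_mod_cast hcompare
    have htot_y := htot y
    calc ((univ.filter fun u : Fin n → Bool => ringWinU c y u = true).card : ℝ)
        ≤ (1 - η₀ / 2) * (2 : ℝ) ^ n := by linarith
      _ ≤ max (1 - η₀ / 2) (1 / 2) * (2 : ℝ) ^ n := mul_le_mul_of_nonneg_right hθ h2n.le


/-- **`WalkHardFShots p` — PROVED for every prime `p ≠ 3`** (route `OddPrimeWalk`, item `ShotsOdd` at fixed `p`). -/
theorem walkHardFShots (p : ℕ) [Fact p.Prime] (hp3 : p ≠ 3) : WalkHardFShots p :=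
  walkHardFShots_of_elimLevel p (elimLevelSqrtF p hp3)

end Summit.QuantumAdvantage.AdviceFreeQNC0

end
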